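import Summits.AtomisticToContinuum.HydrodynamicLimit.Theses.RelayRaceLocality
import Summits.AtomisticToContinuum.HydrodynamicLimit.Theorems.RestartPrinciple.Negative.ConsequentImpAntecedent

/-!
# Disproof of `ConeLocalisation` (stmt-AtomisticToContinuum-12504) — findings

Work file of the crux disprover (cdisprove, cycle 1, opened 2026-08-16/17), seat
refuter-cdisprove-stmt-AtomisticToContinuum-12504-0. Crux decl
`Summit.AtomisticToContinuum.HydrodynamicLimit.Theses.RelayRaceLocality.ConeLocalisation`, route
`RelayRaceLocality` (rank 9 → re-kinded crux, rev 3), no line picked yet (payload `line = null`,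
`targets = []`). Prose lives only in docstrings; every `theorem` is kernel-checked unless its docstring
says NEAR-MISS (none so far: this file has no `sorry`).

The decl is LITERALLY `LightConeInLaw → NearConstantShortTimeHL → S` (`coneLocalisation_iff`, `Iff.rfl`)
with `S = ShortTimeGuardedHL` below: the short-time guarded hydrodynamic limit from local-Gibbs time-0
data, prefix `∃ η₀ ∀ M ∃ τ₁ ∀ profile ∃ σ₀ ∀ σ < σ₀`, guards on `[0, t]` = packing `ρσ³ < η₀`, sizes
`ρ ≤ M`, `θ ∈ [M⁻¹, M]`, `‖u‖ ≤ M`, all `∂, ∂², ∂³` of `(ρ, u, θ)` bounded by `M` — and NO lower bound on `ρ`.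
`S` is verbatim the antecedent of the sibling crux `RestartPrinciple` (stmt-12503).

## Findings (index)

* §1 VERDICT: **no kill, and none is available below summit level.** `¬ ConeLocalisation ↔
  (LightConeInLaw ∧ NearConstantShortTimeHL ∧ ¬ S)` (`not_coneLocalisation_iff`): a disproof must PROVE the
  two open XL antecedents (the light cone in law, the near-constant short-time limit) AND REFUTE `S`; and
  `S` is implied by the summit conjunct (`shortTimeGuardedHL_of_hydrodynamicLimit`, from the tree lemma
  `RestartPrincipleNegative.guardedConjunct_imp_shortTimeGuardedHL`), so
  `¬ ConeLocalisation → ¬ HydrodynamicLimit` (`not_hydrodynamicLimit_of_not_coneLocalisation`): any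
  refutation of this glue is a refutation of the packing-guarded hydrodynamic limit of hard spheres itself.
  Conversely a refuted ANTECEDENT would make the crux vacuously TRUE (prover's ex-falso landing), not
  false; the sibling disprover of `LightConeInLaw` reports no kill either (Cruxes/LightConeInLaw/Disproof.lean
  §0, §6(b): `(HL-gen) ⇒ LightConeInLaw`).
* §2 NON-LOAD-BEARING HYPOTHESIS (checked): the PACKING guard `ρ s x * σ ^ 3 < η₀` of `S` — and with it the
  outer `∃ η₀` — is vestigial: `S ↔ SizeGuardedHL` (`shortTimeGuardedHL_iff_sizeGuardedHL`), because `σ₀` is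
  chosen AFTER `M` and the size guard `ρ ≤ M` gives `ρσ³ ≤ Mσ³ < η₀` once `σ₀ ≤ min 1 (η₀/(M+1))`. Provers may
  drop the packing clause from both the hypothesis they must discharge and the conclusion they aim at;
  planners restating `S` (§3) can delete it. (It is NOT vestigial in the summit conjunct `G`, whose `σ₀`
  precedes `∀ T ∀ solution` with no size guard.)
* §3 THE DENSITY-FLOOR GAP (the reason the crux resists PROOF, recorded so that nobody mistakes it for
  falsity). Both crux ideators (IdeatorOneNotes §2, IdeatorTwoNotes §1) and the first prover found that the
  localisation architecture (flatten → near-constant comparison gas → cone transfer → domain of dependence)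
  reaches only data whose RELATIVE density oscillation over a cone base `B(x, 2ct)` is `≤ 3δ₀(M′)`; `S`'s guard
  class at a FIXED level `M` contains deep smooth density troughs with unbounded `|∇ log ρ|`. Checked here in
  its one-dimensional core: the trough family `trough κ y = 1 - (1 - κ) cos (2π y)` has `κ ≤ trough ≤ 2`, unit
  mean, `|∂ʲ| ≤ (2π)ʲ` for `j ≤ 3` UNIFORMLY in `κ ∈ [0, 1]` (`abs_deriv_trough_le`, `…deriv2…`, `…deriv3…`), yet its
  relative oscillation over any fixed window `[0, h]` is unbounded as `κ ↓ 0` (`trough_relOsc_unbounded`); with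
  a floor `m ≤ f` and `|f′| ≤ L` the relative oscillation over `[y, y + h]` is `≤ L h / m`
  (`relOsc_le_of_floor`). So `x ↦ trough κ (x 0)` (with `u ≡ 0`, `θ ≡ 1`, any `M ≥ (2π)³ + 2`) is an
  `S`-admissible datum defeating every `NearConstantShortTimeHL`-licensed comparison at every `t > 0` —
  a PROVABILITY gap of the implication through its two hypotheses, not a counterexample to it. The schema
  form: `localisation_schema_false` (coverage-licensed conclusions do not entail floor-free conclusions;
  explicit witness). FLOOR REMOVAL IS NOT LOGIC either: `S♭ → S` fails as a schema
  (`floorRemoval_schema_false`, witness `L m t := t < m` — every datum has SOME floor, yet no floor-uniform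
  horizon follows), so flooring only ONE copy of `S` would break `closes`. REPAIR the ideators propose and
  this file endorses after trying to break it (the floored glue was re-examined: σ-free activity-level
  flattening on an `r(M)`-net, periodise-and-zoom for an `r`-free `C¹` guard, fugacity matching — no new
  gap found): insert
  `M⁻¹ ≤ ρ s x ∧` after `ρ s x ≤ M ∧` in `S`, in BOTH stmt-12504 (consequent) and stmt-12503 (antecedent) —
  `ShortTimeGuardedHLFloored` / `ConeLocalisationFloored` below; `closes` is untouched, `G → S♭` still holds
  (`shortTimeGuardedHLFloored_of_hydrodynamicLimit`), and `ConeLocalisation → ConeLocalisationFloored`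
  (`coneLocalisationFloored_of_coneLocalisation`) so nothing already landed is lost.
* §4 DEGENERATE REGIMES (checked, all harmless): `M < 1` makes the `θ`-guard unsatisfiable
  (`sizeGuards_unsat_of_lt_one`) so those `M`-clauses are vacuous; `T ≤ 0` empties `Ico 0 (min T τ₁)`; `t = 0`
  is the hypothesis itself; the laws are `≪ liouville`, so junk values of `HardSphereFlow.flow` off the good
  set are invisible (sibling files: `localGibbsLaw_absolutelyContinuous`); constant profiles give invariant
  Gibbs laws and constant Euler solutions on both sides. No junk counter-model exists at this level.
* §5 HYPOTHESIS MUTATION of the crux's own two antecedents: `WithoutLightCone := NearConstantShortTimeHL → S`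
  and `WithoutNearConstant := LightConeInLaw → S` have negations `B ∧ ¬S`, `A ∧ ¬S` — undecidable here for the
  reason of §1 (`not_withoutLightCone_iff`, `not_withoutNearConstant_iff`); no `_false_without_` theorem can
  exist for this crux short of settling the summit. Informally both ARE load-bearing for the intended proof:
  without the cone nothing localises (B speaks of near-constant data only); without B nothing identifies a
  limit at `t > 0` (A only compares two gases).
* §6 TARGETS: none (no line picked; `stuck_stubs = []`). NEAR-MISSES: none claimed.

Landed under `Theorems/ConeLocalisation/Negative/` (namespace
`Summit.AtomisticToContinuum.HydrodynamicLimit.Theorems.ConeLocalisationNegative`, importable by ideators /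
planners / the lead): `RefutationReducesToSummit.lean` (p132898 ACCEPTED: §1,
`not_hydrodynamicLimit_of_not_coneLocalisation`, `not_coneLocalisation_iff`), `PackingGuardVestigial.lean`
(p132929 ACCEPTED: §2, `packing_of_size`, `shortTimeGuardedHL_iff_sizeGuardedHL`,
`coneLocalisation_imp_sizeGuarded`), `TroughFamily.lean` (p132963 ACCEPTED: §3, trough family bounds,
`trough_relOsc_unbounded`, `relOsc_le_of_floor`, `localisation_schema_false`, `trough_schema_false`),
`FloorRemovalSchema.lean` (p133018 ACCEPTED: §3, `floorRemoval_schema_false`, `floorUniformHorizon_schema_false`,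
`floored_schema_pointwise`).
-/

noncomputable section

open Literature.MathematicalPhysics.KineticTheory Literature.Analysis.FluidPDE
open Literature.Analysis.FunctionSpaces MeasureTheory Filter Set Topology Real
open Summit.AtomisticToContinuum.HydrodynamicLimit.Theses.RelayRaceLocality
open Summit.AtomisticToContinuum.HydrodynamicLimit.Theorems.RestartPrincipleNegative

namespace Summit.AtomisticToContinuum.HydrodynamicLimit.Cruxes.ConeLocalisation.Disproof

/-! ## §1 Anatomy: `ConeLocalisation = (A → B → S)`; a refutation would refute the summit -/

/-- `S`, the consequent of the crux: the short-time guarded hydrodynamic limit from local-Gibbs time-0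
data (verbatim; = antecedent of `RestartPrinciple`, stmt-12503). -/
def ShortTimeGuardedHL : Prop :=
  ∃ η₀ : ℝ, 0 < η₀ ∧ ∀ M : ℝ, 0 < M → ∃ τ₁ : ℝ, 0 < τ₁ ∧ ∀ (a₀ θ₀ : T3 → ℝ) (u₀ : T3 → V3), Continuous a₀ → Continuous θ₀ → Continuous u₀ → (∀ x, 0 < a₀ x) → (∀ x, 0 < θ₀ x) → ∃ σ₀ : ℝ, 0 < σ₀ ∧ ∀ σ : ℝ, 0 < σ → σ < σ₀ → ∀ (T : ℝ) (ρ θ : ℝ → T3 → ℝ) (u : ℝ → T3 → V3), IsHardSphereEulerSolution σ T ρ u θ → ∀ Φ : (N : ℕ) → HardSphereFlow (Torus.geometry (Fin 3)) (hsDiameter σ N) (N + 1), TendstoHydroFieldsAt (fun N => localGibbsLaw σ a₀ u₀ θ₀ N (Φ N)) Φ ρ u θ 0 → ∀ t ∈ Set.Ico 0 (min T τ₁), (∀ s ∈ Set.Icc 0 t, ∀ x, ρ s x * σ ^ 3 < η₀ ∧ ρ s x ≤ M ∧ θ s x ≤ M ∧ M⁻¹ ≤ θ s x ∧ ‖u s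 x‖ ≤ M ∧ ∀ i j k : Fin 3, |Torus.partialDeriv i (ρ s) x| ≤ M ∧ ‖Torus.partialDeriv i (u s) x‖ ≤ M ∧ |Torus.partialDeriv i (θ s) x| ≤ M ∧ |Torus.partialDeriv i (Torus.partialDeriv j (ρ s)) x| ≤ M ∧ ‖Torus.partialDeriv i (Torus.partialDeriv j (u s)) x‖ ≤ M ∧ |Torus.partialDeriv i (Torus.partialDeriv j (θ s)) x| ≤ M ∧ |Torus.partialDeriv i (Torus.partialDeriv j (Torus.partialDeriv k (ρ s))) x| ≤ M ∧ ‖Torus.partialDeriv i (Torus.partialDeriv j (Torus.partialDeriv k (u s))) x‖ ≤ M ∧ |Torus.partialDeriv i (Torus.partialDeriv j (Torus.partialDeriv k (θ s))) x| ≤ M) → TendstoHydroFieldsAt (fun N => localGibbsLaw σ a₀ u₀ θ₀ N (Φ N)) Φ ρ u θ t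

/-- `G`, the packing-guarded summit conjunct, spelled out (verbatim the body of `_root_.HydrodynamicLimit`). -/
def GuardedConjunct : Prop :=
  ∃ η₀ : ℝ, 0 < η₀ ∧ ∀ (a₀ θ₀ : T3 → ℝ) (u₀ : T3 → V3), Continuous a₀ → Continuous θ₀ → Continuous u₀ → (∀ x, 0 < a₀ x) → (∀ x, 0 < θ₀ x) → ∃ σ₀ : ℝ, 0 < σ₀ ∧ ∀ σ : ℝ, 0 < σ → σ < σ₀ → ∀ (T : ℝ) (ρ θ : ℝ → T3 → ℝ) (u : ℝ → T3 → V3), IsHardSphereEulerSolution σ T ρ u θ → (∀ t ∈ Set.Ico 0 T, ∀ x, ρ t x * σ ^ 3 < η₀) → ∀ Φ : (N : ℕ) → HardSphereFlow (Torus.geometry (Fin 3)) (hsDiameter σ N) (N + 1), TendstoHydroFieldsAt (fun N => localGibbsLaw σ a₀ u₀ θ₀ N (Φ N)) Φ ρ u θ 0 → ∀ t ∈ Set.Ico 0 T, TendstoHydroFieldsAt (fun N => localGibbsLaw σ a₀ u₀ θ₀ N (Φ N)) Φ ρ u θ t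

/-- The crux is literally `LightConeInLaw → NearConstantShortTimeHL → S`. -/
theorem coneLocalisation_iff :
    ConeLocalisation ↔ (LightConeInLaw → NearConstantShortTimeHL → ShortTimeGuardedHL) := Iff.rfl

/-- The summit conjunct is literally `G`. -/
theorem hydrodynamicLimit_iff : _root_.HydrodynamicLimit ↔ GuardedConjunct := Iff.rfl

/-- `G → S`: the summit conjunct implies the consequent of the crux (tree lemma of the sibling disprover,
restriction of the classical solution past `t` keeping the strict packing guard). -/
theorem shortTimeGuardedHL_of_hydrodynamicLimit (hG : _root_.HydrodynamicLimit) : ShortTimeGuardedHL :=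
  guardedConjunct_imp_shortTimeGuardedHL hG

/-- `S → crux` (weakening). -/
theorem coneLocalisation_of_shortTimeGuardedHL (hS : ShortTimeGuardedHL) : ConeLocalisation :=
  fun _ _ => hS

/-- The summit conjunct implies the crux. -/
theorem coneLocalisation_of_hydrodynamicLimit (hG : _root_.HydrodynamicLimit) : ConeLocalisation :=
  coneLocalisation_of_shortTimeGuardedHL (shortTimeGuardedHL_of_hydrodynamicLimit hG)

/-- **Any refutation of `ConeLocalisation` refutes the summit conjunct `HydrodynamicLimit`.** -/
theorem not_hydrodynamicLimit_of_not_coneLocalisation (h : ¬ ConeLocalisation) :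
    ¬ _root_.HydrodynamicLimit :=
  fun hG => h (coneLocalisation_of_hydrodynamicLimit hG)

/-- WHAT A DISPROOF OF THE CRUX IS, exactly: a proof of BOTH open antecedents together with a refutation
of the short-time guarded limit `S`. -/
theorem not_coneLocalisation_iff :
    ¬ ConeLocalisation ↔ (LightConeInLaw ∧ NearConstantShortTimeHL ∧ ¬ ShortTimeGuardedHL) := by
  rw [coneLocalisation_iff]
  constructor
  · intro h
    by_contra hc
    exact h fun hA hB => by_contra fun hS => hc ⟨hA, hB, hS⟩
  · rintro ⟨hA, hB, hS⟩ h
    exact hS (h hA hB)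

/-- Under its two antecedents the crux is equivalent to `S` itself. -/
theorem coneLocalisation_iff_of_inputs (hA : LightConeInLaw) (hB : NearConstantShortTimeHL) :
    ConeLocalisation ↔ ShortTimeGuardedHL :=
  ⟨fun h => h hA hB, fun hS _ _ => hS⟩

/-! ## §2 The packing guard of `S` is vestigial (`σ₀` is chosen after `M`; `ρ ≤ M`) -/

/-- The size guards of `S` at level `M` WITHOUT the packing clause: `ρ ≤ M`, `θ ∈ [M⁻¹, M]`, `‖u‖ ≤ M`,
and all derivatives of order `≤ 3` of `(ρ, u, θ)` bounded by `M`, at time `s` and point `x`. -/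
def SizeGuards (M : ℝ) (ρ θ : ℝ → T3 → ℝ) (u : ℝ → T3 → V3) (s : ℝ) (x : T3) : Prop :=
  ρ s x ≤ M ∧ θ s x ≤ M ∧ M⁻¹ ≤ θ s x ∧ ‖u s x‖ ≤ M ∧ ∀ i j k : Fin 3, |Torus.partialDeriv i (ρ s) x| ≤ M ∧ ‖Torus.partialDeriv i (u s) x‖ ≤ M ∧ |Torus.partialDeriv i (θ s) x| ≤ M ∧ |Torus.partialDeriv i (Torus.partialDeriv j (ρ s)) x| ≤ M ∧ ‖Torus.partialDeriv i (Torus.partialDeriv j (u s)) x‖ ≤ M ∧ |Torus.partialDeriv i (Torus.partialDeriv j (θ s)) x| ≤ M ∧ |Torus.partialDeriv i (Torus.partialDeriv j (Torus.partialDeriv k (ρ s))) x| ≤ M ∧ ‖Torus.partialDeriv i (Torus.partialDeriv j (Torus.partialDeriv k (u s))) x‖ ≤ M ∧ |Torus.partialDeriv i (Torus.partialDeriv j (Torus.partialDeriv k (θ s))) x| ≤ M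

/-- `S` with the packing guard (and `η₀`) deleted: prefix `∀ M ∃ τ₁ ∀ profile ∃ σ₀ ∀ σ < σ₀`. -/
def SizeGuardedHL : Prop :=
  ∀ M : ℝ, 0 < M → ∃ τ₁ : ℝ, 0 < τ₁ ∧ ∀ (a₀ θ₀ : T3 → ℝ) (u₀ : T3 → V3), Continuous a₀ → Continuous θ₀ → Continuous u₀ → (∀ x, 0 < a₀ x) → (∀ x, 0 < θ₀ x) → ∃ σ₀ : ℝ, 0 < σ₀ ∧ ∀ σ : ℝ, 0 < σ → σ < σ₀ → ∀ (T : ℝ) (ρ θ : ℝ → T3 → ℝ) (u : ℝ → T3 → V3), IsHardSphereEulerSolution σ T ρ u θ → ∀ Φ : (N : ℕ) → HardSphereFlow (Torus.geometry (Fin 3)) (hsDiameter σ N) (N + 1), TendstoHydroFieldsAt (fun N => localGibbsLaw σ a₀ u₀ θ₀ N (Φ N)) Φ ρ u θ 0 → ∀ t ∈ Set.Ico 0 (min T τ₁), (∀ s ∈ Set.Icc 0 t, ∀ x, SizeGuards M ρ θ u s x) → TendstoHydroFieldsAt (fun N => localGibbsLaw σ a₀ u₀ θ₀ N (Φ N))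 Φ ρ u θ t

/-- Arithmetic of §2: `0 < σ < min 1 (η₀ / (M + 1))`, `ρ ≤ M`, `0 < M` give `ρ σ³ < η₀`. -/
theorem packing_of_size {η₀ M σ r : ℝ} (hM : 0 < M) (hσ : 0 < σ) (hσ1 : σ < 1)
    (hσe : σ < η₀ / (M + 1)) (hr : r ≤ M) : r * σ ^ 3 < η₀ := by
  have hσ3 : σ ^ 3 ≤ σ := by nlinarith [sq_nonneg σ, mul_pos hσ hσ]
  have h1 : r * σ ^ 3 ≤ M * σ ^ 3 := mul_le_mul_of_nonneg_right hr (by positivity)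
  have h2 : M * σ ^ 3 ≤ M * σ := mul_le_mul_of_nonneg_left hσ3 hM.le
  have h3 : M * σ < M * (η₀ / (M + 1)) := mul_lt_mul_of_pos_left hσe hM
  have hM1 : (0 : ℝ) < M + 1 := by linarith
  have hη₀ : 0 < η₀ := by
    have : 0 < η₀ / (M + 1) := lt_trans hσ hσe
    exact (div_pos_iff_of_pos_right hM1).1 this
  have h4 : M * (η₀ / (M + 1)) ≤ η₀ := by
    rw [mul_div_assoc', div_le_iff₀ hM1]
    nlinarith
  linarith

/-- **The packing guard of `S` is not load-bearing**: `S ↔ SizeGuardedHL`. (`→`: shrink `σ₀` to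
`min σ₀ (min 1 (η₀/(M+1)))`, then `ρ ≤ M` implies the packing clause; `←`: take `η₀ := 1` and forget it.) -/
theorem shortTimeGuardedHL_iff_sizeGuardedHL : ShortTimeGuardedHL ↔ SizeGuardedHL := by
  constructor
  · rintro ⟨η₀, hη₀, H⟩ M hM
    obtain ⟨τ₁, hτ₁, H1⟩ := H M hM
    refine ⟨τ₁, hτ₁, fun a₀ θ₀ u₀ ha hθ hu ha0 hθ0 => ?_⟩
    obtain ⟨σ₀, hσ₀, H2⟩ := H1 a₀ θ₀ u₀ ha hθ hu ha0 hθ0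
    refine ⟨min σ₀ (min 1 (η₀ / (M + 1))),
      lt_min hσ₀ (lt_min one_pos (div_pos hη₀ (by linarith))), ?_⟩
    intro σ hσ hσlt T ρ θ u hsol Φ h0 t ht hg
    have hσ₁ : σ < σ₀ := lt_of_lt_of_le hσlt (min_le_left _ _)
    have hσ1 : σ < 1 := lt_of_lt_of_le hσlt ((min_le_right _ _).trans (min_le_left _ _))
    have hσe : σ < η₀ / (M + 1) := lt_of_lt_of_le hσlt ((min_le_right _ _).trans (min_le_right _ _))
    refine H2 σ hσ hσ₁ T ρ θ u hsol Φ h0 t ht fun s hs x => ?_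
    obtain ⟨g1, g2⟩ := hg s hs x
    exact ⟨packing_of_size hM hσ hσ1 hσe g1, g1, g2⟩
  · intro H
    refine ⟨1, one_pos, fun M hM => ?_⟩
    obtain ⟨τ₁, hτ₁, H1⟩ := H M hM
    refine ⟨τ₁, hτ₁, fun a₀ θ₀ u₀ ha hθ hu ha0 hθ0 => ?_⟩
    obtain ⟨σ₀, hσ₀, H2⟩ := H1 a₀ θ₀ u₀ ha hθ hu ha0 hθ0
    exact ⟨σ₀, hσ₀, fun σ hσ hσ₁ T ρ θ u hsol Φ h0 t ht hg =>
      H2 σ hσ hσ₁ T ρ θ u hsol Φ h0 t ht fun s hs x => (hg s hs x).2⟩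

/-- Hence the crux itself may be read without the packing clause. -/
theorem coneLocalisation_iff_sizeGuarded :
    ConeLocalisation ↔ (LightConeInLaw → NearConstantShortTimeHL → SizeGuardedHL) := by
  rw [coneLocalisation_iff, shortTimeGuardedHL_iff_sizeGuardedHL]

/-! ## §3 The density-floor gap: floored statements, and the trough family -/

/-- `S♭`: `S` with the density floor `M⁻¹ ≤ ρ s x` inserted after `ρ s x ≤ M` (the ideators' repair of
stmt-12504's consequent and stmt-12503's antecedent). -/
def ShortTimeGuardedHLFloored : Prop :=
  ∃ η₀ : ℝ, 0 < η₀ ∧ ∀ M : ℝ, 0 < M → ∃ τ₁ : ℝ, 0 < τ₁ ∧ ∀ (a₀ θ₀ : T3 → ℝ) (u₀ : T3 → V3), Continuous a₀ → Continuous θ₀ → Continuous u₀ → (∀ x, 0 < a₀ x) → (∀ x, 0 < θ₀ x) → ∃ σ₀ : ℝ, 0 < σ₀ ∧ ∀ σ : ℝ, 0 < σ → σ < σ₀ → ∀ (T : ℝ) (ρ θ : ℝ → T3 → ℝ) (u : ℝ → T3 → V3), IsHardSphereEulerSolution σ T ρ u θ → ∀ Φ : (N : ℕ) → HardSphereFlow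 (Torus.geometry (Fin 3)) (hsDiameter σ N) (N + 1), TendstoHydroFieldsAt (fun N => localGibbsLaw σ a₀ u₀ θ₀ N (Φ N)) Φ ρ u θ 0 → ∀ t ∈ Set.Ico 0 (min T τ₁), (∀ s ∈ Set.Icc 0 t, ∀ x, ρ s x * σ ^ 3 < η₀ ∧ ρ s x ≤ M ∧ M⁻¹ ≤ ρ s x ∧ θ s x ≤ M ∧ M⁻¹ ≤ θ s x ∧ ‖u s x‖ ≤ M ∧ ∀ i j k : Fin 3, |Torus.partialDeriv i (ρ s) x| ≤ M ∧ ‖Torus.partialDeriv i (u s) x‖ ≤ M ∧ |Torus.partialDeriv i (θ s) x| ≤ M ∧ |Torus.partialDeriv i (Torus.partialDeriv j (ρ s)) x| ≤ M ∧ ‖Torus.partialDeriv i (Torus.partialDeriv j (u s)) x‖ ≤ M ∧ |Torus.partialDeriv i (Torus.partialDeriv j (θ s)) x| ≤ M ∧ |Torus.partialDeriv i (Torus.partialDeriv j (Torus.partialDeriv k (ρ s))) x| ≤ M ∧ ‖Torus.partialDeriv i (Torus.partialDeriv j (Torus.partialDeriv k (u s))) x‖ ≤ M ∧ |Torus.partialDeriv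 i (Torus.partialDeriv j (Torus.partialDeriv k (θ s))) x| ≤ M) → TendstoHydroFieldsAt (fun N => localGibbsLaw σ a₀ u₀ θ₀ N (Φ N)) Φ ρ u θ t

/-- `crux♭ := LightConeInLaw → NearConstantShortTimeHL → S♭` (the repaired crux). -/
def ConeLocalisationFloored : Prop :=
  LightConeInLaw → NearConstantShortTimeHL → ShortTimeGuardedHLFloored

/-- `S → S♭` (more guards in the hypothesis). -/
theorem shortTimeGuardedHLFloored_of_shortTimeGuardedHL (hS : ShortTimeGuardedHL) :
    ShortTimeGuardedHLFloored := by
  obtain ⟨η₀, hη₀, H⟩ := hS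
  refine ⟨η₀, hη₀, fun M hM => ?_⟩
  obtain ⟨τ₁, hτ₁, H1⟩ := H M hM
  refine ⟨τ₁, hτ₁, fun a₀ θ₀ u₀ ha hθ hu ha0 hθ0 => ?_⟩
  obtain ⟨σ₀, hσ₀, H2⟩ := H1 a₀ θ₀ u₀ ha hθ hu ha0 hθ0
  exact ⟨σ₀, hσ₀, fun σ hσ hσ₁ T ρ θ u hsol Φ h0 t ht hg =>
    H2 σ hσ hσ₁ T ρ θ u hsol Φ h0 t ht fun s hs x =>
      ⟨(hg s hs x).1, (hg s hs x).2.1, (hg s hs x).2.2.2⟩⟩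

/-- The repaired crux is implied by the filed one: nothing landed so far is lost by the repair. -/
theorem coneLocalisationFloored_of_coneLocalisation (h : ConeLocalisation) : ConeLocalisationFloored :=
  fun hA hB => shortTimeGuardedHLFloored_of_shortTimeGuardedHL (h hA hB)

/-- `G → S♭`: the repaired consequent is still implied by the summit conjunct (so the repaired
`RestartPrinciple♭ = (S♭ → G)` keeps the tightness `¬ RP♭ ↔ S♭ ∧ ¬ G` of the sibling file). -/
theorem shortTimeGuardedHLFloored_of_hydrodynamicLimit (hG : _root_.HydrodynamicLimit) :
    ShortTimeGuardedHLFloored :=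
  shortTimeGuardedHLFloored_of_shortTimeGuardedHL (shortTimeGuardedHL_of_hydrodynamicLimit hG)

/-- The one-dimensional TROUGH FAMILY `trough κ y = 1 - (1 - κ) cos (2π y)`: `1`-periodic, mean `1`,
minimum `κ` at `y = 0`, maximum `2 - κ` at `y = 1/2`. Its lift `x ↦ trough κ (x 0)` to `𝕋³` (with `u ≡ 0`,
`θ ≡ 1`) is a unit-mass smooth positive Euler datum obeying every size guard of `S` at the FIXED level
`M = (2π)³ + 2` for all `κ ∈ (0, 1]`, realised by a continuous positive activity profile (activity inversion,
tree `activity_inversion_continuous`). -/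
def trough (κ y : ℝ) : ℝ := 1 - (1 - κ) * Real.cos (2 * π * y)

theorem trough_zero (κ : ℝ) : trough κ 0 = κ := by simp [trough]

theorem trough_sub_trough_zero (κ y : ℝ) :
    trough κ y - trough κ 0 = (1 - κ) * (1 - Real.cos (2 * π * y)) := by
  rw [trough_zero, trough]; ring

/-- Floor and ceiling of the trough family: `κ ≤ trough κ y ≤ 2 - κ` for `κ ≤ 1`. -/
theorem le_trough {κ : ℝ} (hκ1 : κ ≤ 1) (y : ℝ) : κ ≤ trough κ y := by
  have hc := Real.cos_le_one (2 * π * y)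
  unfold trough; nlinarith

theorem trough_le {κ : ℝ} (hκ1 : κ ≤ 1) (y : ℝ) : trough κ y ≤ 2 - κ := by
  have hc := Real.neg_one_le_cos (2 * π * y)
  unfold trough; nlinarith

theorem hasDerivAt_trough (κ y : ℝ) :
    HasDerivAt (trough κ) ((1 - κ) * (2 * π) * Real.sin (2 * π * y)) y := by
  have h1 : HasDerivAt (fun y : ℝ => 2 * π * y) (2 * π) y := by
    simpa using (hasDerivAt_id y).const_mul (2 * π)
  have h2 := ((h1.cos).const_mul (1 - κ)).const_sub 1
  show HasDerivAt (fun y => 1 - (1 - κ) * Real.cos (2 * π * y)) _ y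
  exact h2.congr_deriv (by ring)

theorem deriv_trough (κ : ℝ) :
    deriv (trough κ) = fun y => (1 - κ) * (2 * π) * Real.sin (2 * π * y) :=
  funext fun y => (hasDerivAt_trough κ y).deriv

theorem hasDerivAt_deriv_trough (κ y : ℝ) :
    HasDerivAt (deriv (trough κ)) ((1 - κ) * (2 * π) ^ 2 * Real.cos (2 * π * y)) y := by
  rw [deriv_trough]
  have h1 : HasDerivAt (fun y : ℝ => 2 * π * y) (2 * π) y := by
    simpa using (hasDerivAt_id y).const_mul (2 * π)
  have h2 := (h1.sin).const_mul ((1 - κ) * (2 * π))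
  exact h2.congr_deriv (by ring)

theorem deriv2_trough (κ : ℝ) :
    deriv^[2] (trough κ) = fun y => (1 - κ) * (2 * π) ^ 2 * Real.cos (2 * π * y) :=
  funext fun y => (hasDerivAt_deriv_trough κ y).deriv

theorem hasDerivAt_deriv2_trough (κ y : ℝ) :
    HasDerivAt (deriv^[2] (trough κ)) (-((1 - κ) * (2 * π) ^ 3 * Real.sin (2 * π * y))) y := by
  rw [deriv2_trough]
  have h1 : HasDerivAt (fun y : ℝ => 2 * π * y) (2 * π) y := by
    simpa using (hasDerivAt_id y).const_mul (2 * π)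
  have h2 := (h1.cos).const_mul ((1 - κ) * (2 * π) ^ 2)
  exact h2.congr_deriv (by ring)

theorem deriv3_trough (κ : ℝ) :
    deriv^[3] (trough κ) = fun y => -((1 - κ) * (2 * π) ^ 3 * Real.sin (2 * π * y)) :=
  funext fun y => (hasDerivAt_deriv2_trough κ y).deriv

/-- Arithmetic of the `C³` bounds: `|(1 - κ) · c · s| ≤ c` for `κ ∈ [0, 1]`, `c ≥ 0`, `|s| ≤ 1`. -/
theorem abs_amp_mul_le {κ c s : ℝ} (hκ0 : 0 ≤ κ) (hκ1 : κ ≤ 1) (hc : 0 ≤ c) (hs : |s| ≤ 1) :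
    |(1 - κ) * c * s| ≤ c := by
  have h1 : (1 - κ) * |s| ≤ 1 := by nlinarith [abs_nonneg s]
  calc |(1 - κ) * c * s| = c * ((1 - κ) * |s|) := by
        rw [abs_mul, abs_mul, abs_of_nonneg (by linarith : (0:ℝ) ≤ 1 - κ), abs_of_nonneg hc]; ring
    _ ≤ c * 1 := mul_le_mul_of_nonneg_left h1 hc
    _ = c := mul_one _

/-- Uniform `C³` bounds of the trough family: `|trough′| ≤ 2π`, `|trough″| ≤ (2π)²`, `|trough‴| ≤ (2π)³`,
for every `κ ∈ [0, 1]` — the level `M` of `S`'s guards does not see `κ`. -/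
theorem abs_deriv_trough_le {κ : ℝ} (hκ0 : 0 ≤ κ) (hκ1 : κ ≤ 1) (y : ℝ) :
    |deriv (trough κ) y| ≤ 2 * π := by
  simp only [deriv_trough]
  exact abs_amp_mul_le hκ0 hκ1 (by positivity) (Real.abs_sin_le_one _)

theorem abs_deriv2_trough_le {κ : ℝ} (hκ0 : 0 ≤ κ) (hκ1 : κ ≤ 1) (y : ℝ) :
    |deriv^[2] (trough κ) y| ≤ (2 * π) ^ 2 := by
  simp only [deriv2_trough]
  exact abs_amp_mul_le hκ0 hκ1 (by positivity) (Real.abs_cos_le_one _)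

theorem abs_deriv3_trough_le {κ : ℝ} (hκ0 : 0 ≤ κ) (hκ1 : κ ≤ 1) (y : ℝ) :
    |deriv^[3] (trough κ) y| ≤ (2 * π) ^ 3 := by
  simp only [deriv3_trough, abs_neg]
  exact abs_amp_mul_le hκ0 hκ1 (by positivity) (Real.abs_sin_le_one _)

/-- **Unbounded relative oscillation inside a fixed guard class**: for every window `h ∈ (0, 1)` and every
`K`, some member of the trough family has `trough κ h - trough κ 0 > K · trough κ 0` (relative oscillation
`> K` over `[0, h]`), although all members share the `C³` bounds above and the floor `κ > 0`. With
`h = 2 c t` this defeats, at every `t > 0`, the relative-oscillation bound `≤ 3 δ₀(M′)` that any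
`NearConstantShortTimeHL`-licensed comparison gas agreeing with the datum on a cone base `B(x, 2ct)` must
satisfy (IdeatorTwoNotes §1). -/
theorem trough_relOsc_unbounded {h : ℝ} (hh0 : 0 < h) (hh1 : h < 1) (K : ℝ) :
    ∃ κ : ℝ, 0 < κ ∧ κ < 1 ∧ K * trough κ 0 < trough κ h - trough κ 0 := by
  set g : ℝ := 1 - Real.cos (2 * π * h) with hg
  have hgpos : 0 < g := by
    have hne : Real.cos (2 * π * h) ≠ 1 := by
      intro hc
      have hlt1 : -(2 * π) < 2 * π * h := by nlinarith [Real.pi_pos]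
      have hlt2 : 2 * π * h < 2 * π := by nlinarith [Real.pi_pos]
      have := (Real.cos_eq_one_iff_of_lt_of_lt hlt1 hlt2).1 hc
      nlinarith [Real.pi_pos]
    have hle := Real.cos_le_one (2 * π * h)
    rw [hg]
    exact sub_pos.2 (lt_of_le_of_ne hle hne)
  refine ⟨min (1 / 2) (g / (2 * (|K| + 1))), lt_min (by norm_num) (by positivity),
    lt_of_le_of_lt (min_le_left _ _) (by norm_num), ?_⟩
  set κ : ℝ := min (1 / 2) (g / (2 * (|K| + 1))) with hκ
  have hκpos : 0 < κ := lt_min (by norm_num) (by positivity)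
  have hκhalf : κ ≤ 1 / 2 := min_le_left _ _
  have hκg : κ ≤ g / (2 * (|K| + 1)) := min_le_right _ _
  rw [trough_sub_trough_zero, trough_zero]
  have hK : K * κ ≤ |K| * κ := mul_le_mul_of_nonneg_right (le_abs_self K) hκpos.le
  have h1 : |K| * κ ≤ |K| * (g / (2 * (|K| + 1))) := mul_le_mul_of_nonneg_left hκg (abs_nonneg K)
  have h2 : |K| * (g / (2 * (|K| + 1))) < g / 2 := by
    rw [mul_div_assoc', div_lt_div_iff₀ (by positivity) (by positivity)]
    nlinarith [abs_nonneg K]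
  have h3 : g / 2 ≤ (1 - κ) * g := by nlinarith
  linarith

/-- The positive counterpart under a FLOOR: if `m ≤ f` with `0 < m` and `|f′| ≤ L` then the relative
oscillation of `f` over `[y, y + h]`, `0 ≤ h`, is at most `L h / m` — with the floor `M⁻¹ ≤ ρ` of `S♭` and the
guard `|∂ρ| ≤ M`, relative oscillations over cone bases of radius `r` are `≤ 2 M² r`, so a horizon
`τ₁(M) ≍ δ₀(M′)/(c M²)` makes every point coverable (the ideators' constant chain). -/
theorem relOsc_le_of_floor {f : ℝ → ℝ} {m L y h : ℝ} (hm : 0 < m) (hh : 0 ≤ h)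
    (hf : Differentiable ℝ f) (hfloor : ∀ z, m ≤ f z) (hderiv : ∀ z, |deriv f z| ≤ L) :
    f (y + h) - f y ≤ L * h / m * f y := by
  have hmv : ‖f (y + h) - f y‖ ≤ L * ‖y + h - y‖ :=
    Convex.norm_image_sub_le_of_norm_deriv_le (fun z _ => hf.differentiableAt)
      (fun z _ => by simpa [Real.norm_eq_abs] using hderiv z) convex_univ (mem_univ y) (mem_univ (y + h))
  simp only [add_sub_cancel_left, Real.norm_eq_abs, abs_of_nonneg hh] at hmv
  have h1 : f (y + h) - f y ≤ L * h := le_trans (le_abs_self _) hmv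
  have hL : 0 ≤ L * h := le_trans (abs_nonneg _) hmv
  have h2 : L * h ≤ L * h / m * f y := by
    rw [div_mul_eq_mul_div, le_div_iff₀ hm]
    exact mul_le_mul_of_nonneg_left (hfloor y) hL
  linarith

/-- SCHEMA of the gap (explicit witness). Abstract "the hypotheses license the conclusion `L d` for every
datum `d` whose relative oscillation is at most `δ`" and "`S` demands `L d` for every datum of the guard
class"; if the guard class contains a datum of relative oscillation `> δ` (the trough family supplies one at
every fixed level), the licensed conclusions do not entail the demanded ones: take `L d := (osc d ≤ δ)`. -/
theorem localisation_schema_false {D : Type*} (osc : D → ℝ) (guard : D → Prop) (δ : ℝ)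
    (hgap : ∃ d, guard d ∧ δ < osc d) :
    ¬ ∀ L : D → Prop, (∀ d, osc d ≤ δ → L d) → ∀ d, guard d → L d := by
  intro h
  obtain ⟨d, hd, hδ⟩ := hgap
  exact not_le.2 hδ (h (fun d => osc d ≤ δ) (fun d hd' => hd') d hd)

/-- **Floor removal is not logic** (schema, explicit witness). Abstract a datum to its density floor
`m > 0` and "the LLN holds at time `t`" to `L m t`: the floored shape of `S♭` does not entail the floor-free
shape of `S`, witness `L m t := t < m` (LLN up to a time equal to the floor — the caricature of a rarefied
layer with long local mean free time). So `S♭ → S` needs a horizon UNIFORM in the floor, i.e. genuine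
low-density hydrodynamics; and planners must floor BOTH copies of `S` (12504, 12503) or neither. -/
theorem floorRemoval_schema_false :
    ¬ ∀ L : ℝ → ℝ → Prop,
      (∀ M : ℝ, 0 < M → ∃ τ₁ : ℝ, 0 < τ₁ ∧ ∀ m : ℝ, M⁻¹ ≤ m → ∀ t ∈ Set.Ico (0:ℝ) τ₁, L m t) →
      (∀ M : ℝ, 0 < M → ∃ τ₁ : ℝ, 0 < τ₁ ∧ ∀ m : ℝ, 0 < m → ∀ t ∈ Set.Ico (0:ℝ) τ₁, L m t) := by
  intro h
  have hfl : ∀ M : ℝ, 0 < M → ∃ τ₁ : ℝ, 0 < τ₁ ∧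
      ∀ m : ℝ, M⁻¹ ≤ m → ∀ t ∈ Set.Ico (0:ℝ) τ₁, t < m :=
    fun M hM => ⟨M⁻¹, inv_pos.2 hM, fun m hm t ht => lt_of_lt_of_le ht.2 hm⟩
  obtain ⟨τ₁, hτ₁, H⟩ := h (fun m t => t < m) hfl 1 one_pos
  have := H (τ₁ / 2) (by positivity) (τ₁ / 2) ⟨by positivity, by linarith⟩
  linarith

/-- No FIXED floor-uniform horizon follows from the floored schema either. -/
theorem floorUniformHorizon_schema_false (τ₁ : ℝ) (hτ₁ : 0 < τ₁) :
    ¬ ∀ L : ℝ → ℝ → Prop,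
      (∀ M : ℝ, 0 < M → ∃ τ : ℝ, 0 < τ ∧ ∀ m : ℝ, M⁻¹ ≤ m → ∀ t ∈ Set.Ico (0:ℝ) τ, L m t) →
      ∀ m : ℝ, 0 < m → ∀ t ∈ Set.Ico (0:ℝ) τ₁, L m t := by
  intro h
  have hfl : ∀ M : ℝ, 0 < M → ∃ τ : ℝ, 0 < τ ∧
      ∀ m : ℝ, M⁻¹ ≤ m → ∀ t ∈ Set.Ico (0:ℝ) τ, t < m :=
    fun M hM => ⟨M⁻¹, inv_pos.2 hM, fun m hm t ht => lt_of_lt_of_le ht.2 hm⟩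
  have := h (fun m t => t < m) hfl (τ₁ / 2) (by positivity) (τ₁ / 2) ⟨by positivity, by linarith⟩
  linarith

/-- For contrast, all that `S♭` offers a FIXED solution: its own floor-dependent horizon. -/
theorem floored_schema_pointwise (L : ℝ → ℝ → Prop)
    (h : ∀ M : ℝ, 0 < M → ∃ τ : ℝ, 0 < τ ∧ ∀ m : ℝ, M⁻¹ ≤ m → ∀ t ∈ Set.Ico (0:ℝ) τ, L m t)
    (m : ℝ) (hm : 0 < m) : ∃ τ : ℝ, 0 < τ ∧ ∀ t ∈ Set.Ico (0:ℝ) τ, L m t := by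
  obtain ⟨τ, hτ, H⟩ := h m⁻¹ (inv_pos.2 hm)
  exact ⟨τ, hτ, fun t ht => H m (by rw [inv_inv]) t ht⟩

/-! ## §4 Degenerate regimes -/

/-- For `0 < M < 1` the temperature guard `θ ≤ M ∧ M⁻¹ ≤ θ` is unsatisfiable, so every `M`-clause of `S`,
`S♭`, `SizeGuardedHL` with `M < 1` holds vacuously (take any `τ₁`): the statement has teeth only for
`M ≥ 1`. -/
theorem sizeGuards_unsat_of_lt_one {M : ℝ} (hM : 0 < M) (hM1 : M < 1) (ρ θ : ℝ → T3 → ℝ)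
    (u : ℝ → T3 → V3) (s : ℝ) (x : T3) : ¬ SizeGuards M ρ θ u s x := by
  rintro ⟨-, h1, h2, -⟩
  have : (1 : ℝ) < M⁻¹ := one_lt_inv_iff₀.2 ⟨hM, hM1⟩
  linarith

/-- Consequently the `M < 1` clauses of `SizeGuardedHL` are free (witness `τ₁ := 1`, any `σ₀`). -/
theorem sizeGuardedHL_clause_of_lt_one {M : ℝ} (hM : 0 < M) (hM1 : M < 1) :
    ∃ τ₁ : ℝ, 0 < τ₁ ∧ ∀ (a₀ θ₀ : T3 → ℝ) (u₀ : T3 → V3), Continuous a₀ → Continuous θ₀ → Continuous u₀ → (∀ x, 0 < a₀ x) → (∀ x, 0 < θ₀ x) → ∃ σ₀ : ℝ, 0 < σ₀ ∧ ∀ σ : ℝ, 0 < σ → σ < σ₀ → ∀ (T : ℝ) (ρ θ : ℝ → T3 → ℝ) (u : ℝ → T3 → V3), IsHardSphereEulerSolution σ T ρ u θ → ∀ Φ : (N : ℕ) → HardSphereFlow (Torus.geometry (Fin 3)) (hsDiameter σ N) (N + 1), TendstoHydroFieldsAt (fun N => localGibbsLaw σ a₀ u₀ θ₀ N (Φ N))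 Φ ρ u θ 0 → ∀ t ∈ Set.Ico 0 (min T τ₁), (∀ s ∈ Set.Icc 0 t, ∀ x, SizeGuards M ρ θ u s x) → TendstoHydroFieldsAt (fun N => localGibbsLaw σ a₀ u₀ θ₀ N (Φ N)) Φ ρ u θ t := by
  refine ⟨1, one_pos, fun a₀ θ₀ u₀ _ _ _ _ _ => ⟨1, one_pos, ?_⟩⟩
  intro σ _ _ T ρ θ u _ Φ _ t ht hg
  exact absurd (hg 0 ⟨le_rfl, ht.1⟩ 0) (sizeGuards_unsat_of_lt_one hM hM1 ρ θ u 0 0)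

/-- `T ≤ 0` (degenerate horizon of the classical solution) empties the time range of `S`. -/
theorem Ico_min_eq_empty_of_nonpos {T τ₁ : ℝ} (hT : T ≤ 0) : Set.Ico 0 (min T τ₁) = ∅ :=
  Set.Ico_eq_empty (not_lt.2 ((min_le_left _ _).trans hT))

/-! ## §5 Hypothesis mutation of the crux's two antecedents (open both ways) -/

/-- `ConeLocalisation` with the light cone dropped. Its negation is `NearConstantShortTimeHL ∧ ¬ S`:
undecidable here (§1). Informally load-bearing: `NearConstantShortTimeHL` speaks only of data
`δ₀`-close to a constant state, and nothing else in the route localises. -/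
def WithoutLightCone : Prop := NearConstantShortTimeHL → ShortTimeGuardedHL

/-- `ConeLocalisation` with the near-constant limit dropped. Its negation is `LightConeInLaw ∧ ¬ S`:
undecidable here (§1). Informally load-bearing: the cone only COMPARES two gases; without a limit theorem
for one of them nothing identifies the fields at `t > 0`. -/
def WithoutNearConstant : Prop := LightConeInLaw → ShortTimeGuardedHL

theorem not_withoutLightCone_iff : ¬ WithoutLightCone ↔ (NearConstantShortTimeHL ∧ ¬ ShortTimeGuardedHL) :=
  Classical.not_imp

theorem not_withoutNearConstant_iff : ¬ WithoutNearConstant ↔ (LightConeInLaw ∧ ¬ ShortTimeGuardedHL) :=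
  Classical.not_imp

/-- Either mutation being refuted would already refute the summit conjunct. -/
theorem not_hydrodynamicLimit_of_not_without (h : ¬ WithoutLightCone ∨ ¬ WithoutNearConstant) :
    ¬ _root_.HydrodynamicLimit := fun hG =>
  h.elim (fun h1 => h1 fun _ => shortTimeGuardedHL_of_hydrodynamicLimit hG)
    (fun h2 => h2 fun _ => shortTimeGuardedHL_of_hydrodynamicLimit hG)

end Summit.AtomisticToContinuum.HydrodynamicLimit.Cruxes.ConeLocalisation.Disproof

end
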